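import Summits.ResolutionOfSingularities.ResolutionOfSingularities.Theorems.FrobeniusLadderFInjectiveMacaulayficationE8WeightedData
import Summits.ResolutionOfSingularities.ResolutionOfSingularities.Theorems.FrobeniusLadderFInjectiveMacaulayficationE8Forms
import Mathlib.RingTheory.MvPolynomial.WeightedHomogeneous
import Mathlib.Algebra.MvPolynomial.PDeriv
import Mathlib.Algebra.MvPolynomial.Equiv
import Mathlib.Algebra.Polynomial.Degree.Domain
import Mathlib.RingTheory.Polynomial.UniqueFactorization
import Mathlib.Algebra.CharP.Lemmas
import Mathlib.Algebra.BigOperators.Fin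
import HarnessLib

/-!
# The normal form `z² + x⁵ + y⁵` of tri-1's specimen `z² + x²y² + x⁵ + y⁵` as a `(2,2,5)`-weighted specimen: the graded-engine data
# (crux `FInjectiveMacaulayfication`, line `graded-engine` §16, calibration G6g = idea-1 matrix row 3 «zxy»)

Support file for crux stmt-ResolutionOfSingularities-15315 (`FrobeniusLadder.FInjectiveMacaulayfication`), chain w45a,
seat res-L1-w45a-stub-3. [OURS · L1 W4.5a; idea-1 r2 TEST MATRIX row 3] — NOT a statement of the manuscript; AI-written, weaker
than expert review.

tri-1's second frontier specimen `z² + x²y² + x⁵ + y⁵` in characteristic `2` (no tower of point blow-ups normalises it, SURVEY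
j023222) becomes, in the coordinates `z′ = z + xy`, the `(2,2,5)`-weighted-homogeneous NORMAL FORM `f = X₂² + X₀⁵ + X₁⁵` (weight
`10`). For the graded engine G5 `stub_gradedConeFiModel` (`w = (2,2,5)`, `N = 10`, `c = (5,5,2)`, `D = 10`) this file supplies the
specimen data of the normal form, characteristic-free except for `hoff`:

* `zxyNF_isWeightedHomogeneous` — weight `10`;
* `zxyNFVeroneseSplitting` — VERONESE SATURATION for `(2,2,5)` and `N = 10` (peel `X₂²`, `X₀⁵`, `X₁⁵`, or `X₀^a X₁^(5-a)` when
  `a₀ + a₁ ≥ 5`; the remaining box has weight `≤ 13`);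
* `prime_zxyNF` — prime over EVERY field, divides no variable (`T² + c`, `c(−T, 0) = −T⁵`: `E8Forms`); `span_zxyNF_isPrime`,
  `zxyNF_X_ne_zero`;
* `zxyNF_offCentreRegular` — an ISOLATED singular point whenever `5 ≠ 0` in `k` (`∂₀f = 5X₀⁴`, `∂₁f = 5X₁⁴`; `X₀, X₁ ∈ P` forces
  `X₂ ∈ P`), and `zxyNF_offOrigin_clause` — the engines' `hoff` at every prime `p ≠ 5` (`E8WeightedData.offOrigin_clause_of_regular`).

The model modulo G5 (normal form at every `p ≠ 5`; the original specimen at `p = 2` by transport along the shear `z ↦ z + xy`) is in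
the companion file `…ZxyGradedFiModel`. All proofs are glue on Mathlib and landed files; no definitions, no named facts. [folklore]
-/

-- single-problem summit: the doubled namespace component is forced
set_option linter.dupNamespace false

noncomputable section

namespace Summit.ResolutionOfSingularities.ResolutionOfSingularities.Theorems.FInjectiveMacaulayfication.ZxyGradedData

open MvPolynomial
open Summit.ResolutionOfSingularities.ResolutionOfSingularities.Theorems.FInjectiveMacaulayfication

/-! ## Weighted homogeneity -/

/-- The `(2,2,5)`-weighted degree in coordinates: `weight ![2,2,5] a = 2a₀ + 2a₁ + 5a₂`. [folklore] -/
theorem weight_eq (a : Fin 3 →₀ ℕ) :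
    Finsupp.weight (![2, 2, 5] : Fin 3 → ℕ) a = 2 * a 0 + 2 * a 1 + 5 * a 2 := by
  rw [Finsupp.weight_apply,
    Finsupp.sum_fintype a (fun i c => c • (![2, 2, 5] : Fin 3 → ℕ) i) (fun _ => zero_smul ℕ _),
    Fin.sum_univ_three]
  simp only [smul_eq_mul, Matrix.cons_val_zero, Matrix.cons_val_one, Matrix.cons_val]
  ring

/-- **`f = X₂² + X₀⁵ + X₁⁵` is `(2,2,5)`-weighted-homogeneous of weight `10`.** [folklore] -/
theorem zxyNF_isWeightedHomogeneous (k : Type) [Field k] :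
    MvPolynomial.IsWeightedHomogeneous (![2, 2, 5] : Fin 3 → ℕ)
      (X 2 ^ 2 + X 0 ^ 5 + X 1 ^ 5 : MvPolynomial (Fin 3) k) 10 := by
  refine ((?_ : IsWeightedHomogeneous _ _ 10).add ?_).add ?_
  · simpa using (isWeightedHomogeneous_X k (![2, 2, 5] : Fin 3 → ℕ) 2).pow 2
  · simpa using (isWeightedHomogeneous_X k (![2, 2, 5] : Fin 3 → ℕ) 0).pow 5
  · simpa using (isWeightedHomogeneous_X k (![2, 2, 5] : Fin 3 → ℕ) 1).pow 5

/-! ## Veronese saturation for `(2,2,5)`, `N = 10` -/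

/-- **Coordinate splitting** for `w = (2,2,5)`, `N = 10`: peel `X₂²`, `X₀⁵`, `X₁⁵` or `X₀^{a₀}X₁^{5-a₀}` (when `a₀ + a₁ ≥ 5`), all
of weight exactly `10`; otherwise the box `a₀ + a₁ ≤ 4, a₂ ≤ 1` has weight `≤ 13` and `K = 0`. [folklore] -/
theorem coord_split (K a₀ a₁ a₂ : ℕ) (h : (K + 1) * 10 ≤ 2 * a₀ + 2 * a₁ + 5 * a₂) :
    ∃ b₀ b₁ b₂ c₀ c₁ c₂ : ℕ, a₀ = b₀ + c₀ ∧ a₁ = b₁ + c₁ ∧ a₂ = b₂ + c₂ ∧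
      10 ≤ 2 * b₀ + 2 * b₁ + 5 * b₂ ∧ K * 10 ≤ 2 * c₀ + 2 * c₁ + 5 * c₂ := by
  by_cases h₂ : 2 ≤ a₂
  · exact ⟨0, 0, 2, a₀, a₁, a₂ - 2, by omega⟩
  by_cases h₀ : 5 ≤ a₀
  · exact ⟨5, 0, 0, a₀ - 5, a₁, a₂, by omega⟩
  by_cases h₁ : 5 ≤ a₁
  · exact ⟨0, 5, 0, a₀, a₁ - 5, a₂, by omega⟩
  by_cases h₀₁ : 5 ≤ a₀ + a₁
  · exact ⟨a₀, 5 - a₀, 0, 0, a₁ - (5 - a₀), a₂, by omega⟩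
  -- the box: weight `≤ 13`, hence `K = 0`
  exact ⟨a₀, a₁, a₂, 0, 0, 0, by omega⟩

/-- **Exponent-vector splitting** (`coord_split` along `Finsupp.equivFunOnFinite`). [folklore] -/
theorem finsupp_split (K : ℕ) (a : Fin 3 →₀ ℕ)
    (ha : (K + 1) * 10 ≤ Finsupp.weight (![2, 2, 5] : Fin 3 → ℕ) a) :
    ∃ b c : Fin 3 →₀ ℕ, a = b + c ∧ 10 ≤ Finsupp.weight (![2, 2, 5] : Fin 3 → ℕ) b ∧
      K * 10 ≤ Finsupp.weight (![2, 2, 5] : Fin 3 → ℕ) c := by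
  rw [weight_eq] at ha
  obtain ⟨b₀, b₁, b₂, c₀, c₁, c₂, e₀, e₁, e₂, hb, hc⟩ := coord_split K (a 0) (a 1) (a 2) ha
  refine ⟨Finsupp.equivFunOnFinite.symm ![b₀, b₁, b₂], Finsupp.equivFunOnFinite.symm ![c₀, c₁, c₂], ?_, ?_, ?_⟩
  · ext i
    fin_cases i <;> simp [e₀, e₁, e₂]
  · rw [weight_eq]
    simpa using hb
  · rw [weight_eq]
    simpa using hc

/-- **VERONESE SATURATION for the weights `(2,2,5)` and `N = 10`** (the `hpow` hypothesis of the graded engine for the normal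
form): every monomial of weighted degree `≥ 10K` lies in `I₁₀^K`. [folklore] -/
theorem zxyNFVeroneseSplitting : ∀ (k : Type) [Field k] (K : ℕ) (a : Fin 3 →₀ ℕ),
    K * 10 ≤ Finsupp.weight (![2, 2, 5] : Fin 3 → ℕ) a →
    (MvPolynomial.monomial a (1 : k) : MvPolynomial (Fin 3) k) ∈
      (Ideal.span {m : MvPolynomial (Fin 3) k | ∃ b : Fin 3 →₀ ℕ,
        10 ≤ Finsupp.weight (![2, 2, 5] : Fin 3 → ℕ) b ∧ m = MvPolynomial.monomial b 1}) ^ K := by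
  intro k _ K
  induction K with
  | zero =>
    intro a _
    rw [pow_zero, Ideal.one_eq_top]
    exact Submodule.mem_top
  | succ K ih =>
    intro a ha
    obtain ⟨b, c, rfl, hb, hc⟩ := finsupp_split K a ha
    have hmul : (MvPolynomial.monomial (b + c) (1 : k) : MvPolynomial (Fin 3) k) =
        MvPolynomial.monomial b 1 * MvPolynomial.monomial c 1 := by
      rw [MvPolynomial.monomial_mul, one_mul]
    rw [pow_succ', hmul]
    exact Ideal.mul_mem_mul (Ideal.subset_span ⟨b, hb, rfl⟩) (ih c hc)

/-! ## Primality over every field -/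

/-- **`f = X₂² + X₀⁵ + X₁⁵` is prime over every field and divides no variable** (`k[X] ≃ k[Y₀,Y₁][T]`, `X₂ ↦ T`, `X₀ ↦ C Y₁`,
`X₁ ↦ C Y₀`; `f ↦ T² + c`, `c = Y₁⁵ + Y₀⁵`, `c(−T, 0) = −T⁵`). [folklore] -/
theorem prime_zxyNF (k : Type) [Field k] (f : MvPolynomial (Fin 3) k)
    (hf : f = X 2 ^ 2 + X 0 ^ 5 + X 1 ^ 5) :
    Prime f ∧ ∀ v : Fin 3, ¬ f ∣ MvPolynomial.X v := by
  obtain ⟨e, he0, he1, he2⟩ : ∃ e : MvPolynomial (Fin 3) k ≃+* Polynomial (MvPolynomial (Fin 2) k),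
      e (X 0) = Polynomial.C (X 1) ∧ e (X 1) = Polynomial.C (X 0) ∧ e (X 2) = Polynomial.X := by
    refine ⟨((renameEquiv k (Equiv.swap (0 : Fin 3) 2)).trans (finSuccEquiv k 2)).toRingEquiv, ?_, ?_, ?_⟩
    · show finSuccEquiv k 2 (rename (Equiv.swap (0 : Fin 3) 2) (X 0)) = _
      rw [rename_X, Equiv.swap_apply_left]
      exact finSuccEquiv_X_succ (j := 1)
    · show finSuccEquiv k 2 (rename (Equiv.swap (0 : Fin 3) 2) (X 1)) = _
      rw [rename_X, Equiv.swap_apply_of_ne_of_ne (by decide) (by decide)]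
      exact finSuccEquiv_X_succ (j := 0)
    · show finSuccEquiv k 2 (rename (Equiv.swap (0 : Fin 3) 2) (X 2)) = _
      rw [rename_X, Equiv.swap_apply_right]
      exact finSuccEquiv_X_zero
  have hef : e f = Polynomial.X ^ 2 + Polynomial.C (X 1 ^ 5 + X 0 ^ 5 : MvPolynomial (Fin 2) k) := by
    subst hf
    simp only [map_add, map_pow, he0, he1, he2]
    ring
  have hc : ∀ a : MvPolynomial (Fin 2) k, a * a ≠ -(X 1 ^ 5 + X 0 ^ 5) :=
    E8Forms.mul_self_ne_neg_of_aeval ![-Polynomial.X, 0] 2 (by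
      simp only [map_add, map_pow, MvPolynomial.aeval_X, Matrix.cons_val_zero, Matrix.cons_val_one]
      ring)
  obtain ⟨hp, hnd⟩ := E8Forms.prime_and_not_dvd_of_ringEquiv e f _ hef hc
  refine ⟨hp, fun v => ?_⟩
  fin_cases v
  · exact hnd (X 0) (X 1) (X_ne_zero 1) he0
  · exact hnd (X 1) (X 0) (X_ne_zero 0) he1
  · rintro ⟨q, hq⟩
    have h1 : (Polynomial.X ^ 2 + Polynomial.C (X 1 ^ 5 + X 0 ^ 5) : Polynomial (MvPolynomial (Fin 2) k)) ∣
        Polynomial.X :=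
      ⟨e q, by rw [← hef, ← map_mul, ← hq]; exact he2.symm⟩
    have h2 := Polynomial.natDegree_le_of_dvd h1 Polynomial.X_ne_zero
    rw [Polynomial.natDegree_X_pow_add_C, Polynomial.natDegree_X] at h2
    omega

/-- `(f)` is a prime ideal. [folklore] -/
theorem span_zxyNF_isPrime (k : Type) [Field k] (f : MvPolynomial (Fin 3) k)
    (hf : f = X 2 ^ 2 + X 0 ^ 5 + X 1 ^ 5) : (Ideal.span {f}).IsPrime :=
  (Ideal.span_singleton_prime (prime_zxyNF k f hf).1.ne_zero).mpr (prime_zxyNF k f hf).1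

/-- No variable lies in `(f)`. [folklore] -/
theorem zxyNF_X_ne_zero (k : Type) [Field k] (f : MvPolynomial (Fin 3) k)
    (hf : f = X 2 ^ 2 + X 0 ^ 5 + X 1 ^ 5) (v : Fin 3) :
    Ideal.Quotient.mk (Ideal.span {f}) (MvPolynomial.X v) ≠ 0 := fun h0 =>
  (prime_zxyNF k f hf).2 v (Ideal.mem_span_singleton.mp (Ideal.Quotient.eq_zero_iff_mem.mp h0))

/-! ## An isolated singular point whenever `5 ≠ 0` -/

/-- `∂₀ (X₂² + X₀⁵ + X₁⁵) = 5X₀⁴`. [folklore] -/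
theorem pderiv_zero_zxyNF {A : Type*} [CommRing A] :
    pderiv 0 (X 2 ^ 2 + X 0 ^ 5 + X 1 ^ 5 : MvPolynomial (Fin 3) A) = C 5 * X 0 ^ 4 := by
  simp only [map_add, pderiv_pow, pderiv_X_self,
    pderiv_X_of_ne (show (2 : Fin 3) ≠ 0 by decide), pderiv_X_of_ne (show (1 : Fin 3) ≠ 0 by decide)]
  rw [map_ofNat]
  norm_num

/-- `∂₁ (X₂² + X₀⁵ + X₁⁵) = 5X₁⁴`. [folklore] -/
theorem pderiv_one_zxyNF {A : Type*} [CommRing A] :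
    pderiv 1 (X 2 ^ 2 + X 0 ^ 5 + X 1 ^ 5 : MvPolynomial (Fin 3) A) = C 5 * X 1 ^ 4 := by
  simp only [map_add, pderiv_pow, pderiv_X_self,
    pderiv_X_of_ne (show (2 : Fin 3) ≠ 1 by decide), pderiv_X_of_ne (show (0 : Fin 3) ≠ 1 by decide)]
  rw [map_ofNat]
  norm_num

/-- **`z² + x⁵ + y⁵ = 0` has an isolated singular point whenever `5 ≠ 0` in `k`**: for a prime `P` of `k[X]/(f)` not containing
`𝔪`, `R_P` is regular (Jacobian with `∂₀f = 5X₀⁴` or `∂₁f = 5X₁⁴`; `X₀, X₁ ∈ P` would force `X₂² ∈ P`, `𝔪 ≤ P`).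
[cite: Matsumura1987, Thm. 30.4 (ii)] -/
theorem zxyNF_offCentreRegular (k : Type) [Field k] (h5 : (5 : k) ≠ 0) (f : MvPolynomial (Fin 3) k)
    (hf : f = X 2 ^ 2 + X 0 ^ 5 + X 1 ^ 5) :
    ∀ (P : Ideal (MvPolynomial (Fin 3) k ⧸ Ideal.span {f})) [P.IsPrime],
      ¬ Ideal.span (Set.range fun j : Fin 3 => Ideal.Quotient.mk (Ideal.span {f}) (MvPolynomial.X j)) ≤ P →
      IsRegularLocalRing (Localization.AtPrime P) := by
  intro P _ hP
  haveI hprime : (P.comap (Ideal.Quotient.mk (Ideal.span {f}))).IsPrime := Ideal.comap_isPrime _ _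
  have hfP : f ∈ P.comap (Ideal.Quotient.mk (Ideal.span {f})) := by
    rw [Ideal.mem_comap, Ideal.Quotient.eq_zero_iff_mem.mpr (Ideal.mem_span_singleton_self f)]
    exact P.zero_mem
  have hd0 : pderiv 0 f = C 5 * X 0 ^ 4 := by rw [hf, pderiv_zero_zxyNF]
  have hd1 : pderiv 1 f = C 5 * X 1 ^ 4 := by rw [hf, pderiv_one_zxyNF]
  by_cases h0 : (X 0 : MvPolynomial (Fin 3) k) ∈ P.comap (Ideal.Quotient.mk (Ideal.span {f}))
  · by_cases h1 : (X 1 : MvPolynomial (Fin 3) k) ∈ P.comap (Ideal.Quotient.mk (Ideal.span {f}))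
    · exfalso
      refine hP ?_
      have h2 : (X 2 : MvPolynomial (Fin 3) k) ∈ P.comap (Ideal.Quotient.mk (Ideal.span {f})) := by
        refine hprime.mem_of_pow_mem 2 ?_
        have e : (X 2 ^ 2 : MvPolynomial (Fin 3) k) = f - X 0 ^ 5 - X 1 ^ 5 := by rw [hf]; ring
        rw [e]
        exact Ideal.sub_mem _ (Ideal.sub_mem _ hfP (Ideal.pow_mem_of_mem _ h0 5 (by norm_num)))
          (Ideal.pow_mem_of_mem _ h1 5 (by norm_num))
      rw [Ideal.span_le, Set.range_subset_iff]
      intro j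
      fin_cases j
      exacts [h0, h1, h2]
    · refine HypersurfaceRegular.stub_hypersurfaceRegularOfPderiv k 3 f 1 P (fun hd => h1 ?_)
      rw [hd1] at hd
      exact hprime.mem_of_pow_mem 4 (E8OffCentreRegular.mem_of_C_mul_mem _ h5 hd)
  · refine HypersurfaceRegular.stub_hypersurfaceRegularOfPderiv k 3 f 0 P (fun hd => h0 ?_)
    rw [hd0] at hd
    exact hprime.mem_of_pow_mem 4 (E8OffCentreRegular.mem_of_C_mul_mem _ h5 hd)

/-- **The off-origin clause for the normal form at every prime `p ≠ 5`** (input `hoff` of the graded engine). [folklore] -/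
theorem zxyNF_offOrigin_clause (p : ℕ) [hp : Fact p.Prime] (hp5 : p ≠ 5) (k : Type) [Field k] [CharP k p]
    (f : MvPolynomial (Fin 3) k) (hf : f = MvPolynomial.X 2 ^ 2 + MvPolynomial.X 0 ^ 5 + MvPolynomial.X 1 ^ 5) :
    ∀ (Q : Ideal (MvPolynomial (Fin 3) k ⧸ Ideal.span {f})) [Q.IsMaximal],
      (∃ j : Fin 3, Ideal.Quotient.mk (Ideal.span {f}) (MvPolynomial.X j) ∉ Q) →
      ∀ d : ℕ, ringKrullDim (Localization.AtPrime Q) = d → ∀ s : Fin d → Localization.AtPrime Q,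
        (Ideal.span (Set.range s)).radical.IsMaximal →
          RingTheory.Sequence.IsWeaklyRegular (Localization.AtPrime Q) (List.ofFn s) ∧
          ∀ y : Localization.AtPrime Q, (∃ e : ℕ, y ^ p ^ e ∈ Ideal.span
            ((fun z : Localization.AtPrime Q => z ^ p ^ e) ''
              (Ideal.span (Set.range s) : Set (Localization.AtPrime Q)))) → y ∈ Ideal.span (Set.range s) := by
  have h5 : (5 : k) ≠ 0 := by
    intro h
    have h' : ((5 : ℕ) : k) = 0 := by exact_mod_cast h
    rw [CharP.cast_eq_zero_iff k p 5] at h'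
    exact hp5 ((Nat.prime_dvd_prime_iff_eq hp.out Nat.prime_five).mp h')
  exact E8WeightedData.offOrigin_clause_of_regular p k f (fun P _ hP => zxyNF_offCentreRegular k h5 f hf P hP)

end Summit.ResolutionOfSingularities.ResolutionOfSingularities.Theorems.FInjectiveMacaulayfication.ZxyGradedData

end
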